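import Summits.QuantumFields.BalabanUV.T4Continuum.Spine.NE3.CurvedLandauNewtonScheme
import Summits.QuantumFields.BalabanUV.T4Continuum.Spine.NE3.SupRegularityCurvedUniform
import Summits.QuantumFields.BalabanUV.T4Continuum.Spine.NE3.LandauProjectionSupCurvedUniform
import HarnessLib

/-!
# T⁴ programme, node NE3 — [B8] AT A CURVED BACKGROUND, brick E′ = THE END: THE EXACT (1.38)-LANDAU REPRESENTATIVE RELATIVE TO A BACKGROUND `W`
# OF BAŁABAN's CLASS EXISTS — `∃ u` unitary periodic, `Z` skew periodic with `U^{u} = vary W Z 1`, `IsLandauB8 L N (j+1) W Z`,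
# `‖W⁻¹U^{u} − 1‖ ≤ r₀ + (5∕2)c₁c_R·M·b₀` — from `‖W⁻¹U − 1‖ ≤ r₀`, `‖covDiv_W log W⁻¹U‖_∞ ≤ b₀` and ONE smallness line; with the tree's LEVEL-FREE
# curved letters plugged: `c₀ = 36d(frameC+d)²`, `c₁ = 36d(frameC+d)`, `c_R = 1 + 2·card n·(64d²N)^d + 27(card n)³512^dN^d` (`CurvedLandauRep`)

Cell `pub-balaban`, rung (B)+1 sub-cell t4, row NE3 (OWNER lineage `b2b-balaban-t4-ne3-p1`, generation 27; technique of record: implicit-function ∕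
contraction mapping).  The CURVED twin of `Spine/NE3/FlatLandauRep` (brick E of REP♭): [Balaban1985RegularSpaces] («B8») Sect. E Prop. 5's
GAUGE-EXISTENCE (sup member) RELATIVE TO A CURVED BACKGROUND `W` of the multi-level small-field class, on the T⁴ programme's lattice — the background of
row NE3's `PairLandauB8.PairLandauGaugeB8` is `W = cavg L U_B` (census `pub-balaban-gaps/ne/NE3.md` R4 «PROVE [B8] Thm 2 on the tree's concrete lattice»,
XL) — over letters 2a′ `CurvedLandauGaugeLetters`, 2b′ `CurvedLandauGaugeStep`, 3′ `CurvedLandauNewtonStep`, 4a′ `CurvedLandauNewtonScheme`, the flat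
letters 1 ∕ 2a, and row NE3's background-generic Landau theory (`LandauProjectionB8.exists_landauB8_correction`, `sum_hsR_gaugeDir_gaugeDir_covLapSite`;
`LandauCorrectionSupB8Flat.sum_hsR_covDiv_add_covLapSite_eq_zero_of_isLandauB8`; the LEVEL-FREE curved sup letters (H0_W)
`SupRegularityCurvedUniform.supRegularity_uniform` and (HR_W) `LandauProjectionSupCurvedUniform.covLapSite_sup_le_curved_uniform` — pub-balaban-gaps ne3).

THE THEOREM (`exists_landauRep_W_of_supFacts`; `d ≥ 1`, `L ≥ 2`, `N ≥ 1`, level `j+1`, `M = L^{j+1}`, `P = N·M`; `W` unitary `P`-periodic with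
`LevelSmall d L j x`, `SmallField W x`; (H0_W), (HR_W) BY SHAPE with `0 ≤ c₀, c₁`, `1 ≤ c_R`).  For unitary `P`-periodic `U` with RELATIVE data
`‖W(b)⁻¹U(b) − 1‖ ≤ r₀`, `‖covDiv_W (log W⁻¹U)(x)‖ ≤ b₀`, in the regime `c₀M²c_Rb₀ ≤ 1∕10`, `c₁Mc_Rb₀ ≤ 1∕25`, `r̄ := r₀ + (5∕2)c₁Mc_Rb₀ ≤ 1∕20` and under
THE LINE `c_R·(4c₀M²(b₀ + 4c_Rb₀) + 25·d·r̄·(c₁M) + 14·d·(c₁M)²·c_Rb₀) ≤ 1∕2`: ∃ unitary `P`-periodic `u`, skew `P`-periodic `Z` with `U^{u} = vary W Z 1`,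
**`IsLandauB8 L N (j+1) W Z`** ((1.38) RELATIVE TO `W`, EXACTLY), `‖W⁻¹U^{u}(b) − 1‖ ≤ r̄`, `‖Z(b)‖ ≤ 2r̄`, `‖u − 1‖ ≤ 4c₀M²c_Rb₀`, `‖covDiv_W Z‖_∞ ≤ b₀ + 3c_Rb₀`.
`exists_landauRep_W` plugs the tree's level-free curved letters under their printed-shape hypotheses on `W` (plaquette-gradient radius `x₁`, lines
`23040d⁴F²M²x ≤ 1`, `11520d⁴F³M³x₁ ≤ 1`, `F = frameC d L + d`).  READING FOR ROW NE3: these are the `landau, sup, rep, unitary, periodic, skew, per`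
members of `LandauRepB8 L N (j+1) W U u Z …` at ANY background of the class — [B8] Prop 5's part of `PairLandauGaugeB8` (R4) — from (−1)∕(−2)-size
RELATIVE data of the pair; NOT the `grad∕holder∕lap` members ([B8] Prop 3 ∕ Lemmas 3–4) and NOT the (1.37) average condition of `PairLandauGaugeB8Avg`.

METHOD: identical to the flat END — Newton on `N(Q′(W))` (`u_{i+1} = e^{λ_i}u_i`), geometric decay of the Landau defect, pointwise limit
(`isClosed_unitary`, `log` 4∕3-Lipschitz, pairing `Σ hsR(Z_i)(D_WΔ_Wν) = −Σ hsR(Δ_Wλ_i)(Δ_Wν) = O(2^{−i})`); the only new algebra is on the bond,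
`W⁻¹V^{w} = (W⁻¹wW)·(W⁻¹V)·w′⁻¹` (letter 2b′).

HONEST FRAMING (page 1): a fixed-point theorem about OUR lattice objects; the curved letters it consumes are PROVED tree theorems with level-free constants;
nothing of Bałaban's is asserted or discharged — [B8] Prop 5 ∕ Thm 2 carry the full (1.36)∕(1.39) regularity ladder and (1.37), of which this is the
sup-member gauge-existence part; the INPUT (a gauge of `U_A` with `W⁻¹U_A` (−1)-close and (−2)-close in covariant divergence) is NOT supplied here;
`PairLandauGaugeB8` ∕ NE3 ∕ NE7 NOT proved; spine PROVED 0∕9; finite T⁴ rung (B)+1 — NOT infinite volume, NOT mass gap, NOT `BetaPertH`, NOT Clay.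
Continuum YM on T⁴ ⇐ BetaPertH ∧ nine spine estimates (0/9 proved); BetaPertH ⇐ (D1) ∧ (D4) ∧ CAP+tail; G-an2-4 gates asym, D1 and NE2/3/4.  PLACEMENT:
our theorem, `Spine/NE3/`.
-/

set_option autoImplicit false

open NormedSpace Filter Topology
open scoped BigOperators Matrix.Norms.L2Operator
open Finset

namespace Summit.QuantumFields.BalabanUV.T4Continuum.NE3.CurvedLandauRep

open Literature.MathematicalPhysics.QuantumFieldTheory.Balaban1983to89
open B7Prop1Explicit B7Prop2Explicit MatrixLog
open T4AveragingDeficitWall (Ad IsUnitaryCfg IsSkewDir vary)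
open T4AveragingDeficitWallBoundary (IsPeriodicCfg periodBox)
open AveragingDeficitPeriodicCounting (IsPeriodicDir)
open AveragingDeficitMultiLevelPrep (LevelSmall)
open T4AveragingDeficitWall (SmallField)
open NE3EnergyShapes (IsUnitarySite IsPeriodicSite)
open NE3CovariantWeitzenbock (covDiv)
open NE3CovariantCalculus (hsR hsR_add_left hsR_sub_left abs_hsR_le)
open BlockAveragePushDirGauge (gaugeDir)
open NE3.PairLandauB8 (avgKernelGauges IsLandauB8 covLapSite)
open NE3.LandauProjectionB8 (sum_hsR_gaugeDir_gaugeDir_covLapSite)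
open NE3RightInverseSupLetters (frameC)
open NE3.SupRegularityCurvedUniform (supRegularity_uniform one_le_frameC_add)
open NE3.LandauProjectionSupCurvedUniform (covLapSite_sup_le_curved_uniform)
open NE7ExpLogSecondOrder (norm_mlog_sub_mlog_le_four_thirds)
open NE3.CurvedLandauNewtonStep (isUnitaryCfg_gaugeAct_W isPeriodicDir_mlog_rel isSkewDir_mlog_rel)
open NE3.CurvedLandauNewtonScheme (exists_newton_sequence_W)

noncomputable section

variable {d : ℕ} {n : Type*} [Fintype n] [DecidableEq n]

/-- For a unitary unit `w`, `w⁻¹ = w†` as matrices. [folklore] -/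
theorem val_inv_eq_star {w : (Matrix n n ℂ)ˣ} (hw : w ∈ unitaryUnits (Matrix n n ℂ)) : (((w⁻¹ : (Matrix n n ℂ)ˣ)) : (Matrix n n ℂ)) = star (w : (Matrix n n ℂ)) :=
  Units.inv_eq_of_mul_eq_one_right (Unitary.mul_star_self_of_mem (mem_unitaryUnits.mp hw))

/-- **THE EXACT (1.38)-LANDAU REPRESENTATIVE RELATIVE TO A BACKGROUND `W` OF THE CLASS — LETTER FORM** (statement in the module docstring; (H0_W) `hG`,
(HR_W) `hR` as hypotheses with constants `0 ≤ c₀, c₁`, `1 ≤ c_R`; `W` unitary periodic with `LevelSmall d L j x`, `SmallField W x`, as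
`LandauProjectionB8.exists_landauB8_correction` needs).  [Balaban1985RegularSpaces] Sect. E Prop. 5 TYPE at `U₀ = W`, sup member; PROVED here by the
Newton scheme of letters 2a′–4a′ and a pointwise limit. [folklore] -/
theorem exists_landauRep_W_of_supFacts [Nonempty n] (hd : 1 ≤ d) {L N : ℕ} (hL : 2 ≤ L) (hN : 1 ≤ N) (j : ℕ) {c₀ c₁ cR : ℝ}
    (hc₀ : 0 ≤ c₀) (hc₁ : 0 ≤ c₁) (hcR : 1 ≤ cR)
    {W : Site d → Fin d → (Matrix n n ℂ)ˣ} (hWu : IsUnitaryCfg W) (hWP : IsPeriodicCfg W ((N * L ^ (j + 1) : ℕ) : ℤ))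
    {x : ℝ} (hx : 0 ≤ x) (hs : LevelSmall d L j x) (hWx : SmallField W x)
    (hG : ∀ mu ∈ avgKernelGauges (d := d) (n := n) L N (j + 1) W, ∀ B : ℝ,
      (∀ y : Site d, ‖covLapSite W mu y‖ ≤ B) →
        (∀ y : Site d, ‖mu y‖ ≤ c₀ * ((L : ℝ) ^ (j + 1)) ^ 2 * B) ∧
        (∀ (y : Site d) (μ : Fin d), ‖gaugeDir W mu y μ‖ ≤ c₁ * (L : ℝ) ^ (j + 1) * B))
    (hR : ∀ (F : Site d → (Matrix n n ℂ)), (∀ y : Site d, F y ∈ skewAdjoint (Matrix n n ℂ)) →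
      (∀ (y : Site d) (i : Fin d), F (y + ((N * L ^ (j + 1) : ℕ) : ℤ) • e i) = F y) →
      ∀ mu ∈ avgKernelGauges (d := d) (n := n) L N (j + 1) W,
        (∀ nu ∈ avgKernelGauges (d := d) (n := n) L N (j + 1) W,
          ∑ y ∈ periodBox (d := d) (N * L ^ (j + 1)),
            hsR (F y + covLapSite W mu y) (covLapSite W nu y) = 0) →
        ∀ B : ℝ, (∀ y : Site d, ‖F y‖ ≤ B) → ∀ y : Site d, ‖covLapSite W mu y‖ ≤ cR * B)
    {U : Site d → Fin d → (Matrix n n ℂ)ˣ} (hUu : IsUnitaryCfg U) (hUP : IsPeriodicCfg U ((N * L ^ (j + 1) : ℕ) : ℤ))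
    {r₀ b₀ : ℝ} (hr₀ : ∀ (y : Site d) (μ : Fin d), ‖(((W y μ)⁻¹ * U y μ : (Matrix n n ℂ)ˣ) : (Matrix n n ℂ)) - 1‖ ≤ r₀)
    (hb₀ : ∀ x : Site d, ‖covDiv W (fun y μ => mlog (((W y μ)⁻¹ * U y μ : (Matrix n n ℂ)ˣ) : (Matrix n n ℂ))) x‖ ≤ b₀)
    (hreg₁ : c₀ * ((L : ℝ) ^ (j + 1)) ^ 2 * (cR * b₀) ≤ 1 / 10) (hreg₂ : c₁ * (L : ℝ) ^ (j + 1) * (cR * b₀) ≤ 1 / 25)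
    (hreg₃ : r₀ + 5 / 2 * (c₁ * (L : ℝ) ^ (j + 1) * (cR * b₀)) ≤ 1 / 20)
    (hline : cR * (4 * (c₀ * ((L : ℝ) ^ (j + 1)) ^ 2) * (b₀ + 4 * (cR * b₀))
        + 25 * d * (r₀ + 5 / 2 * (c₁ * (L : ℝ) ^ (j + 1) * (cR * b₀))) * (c₁ * (L : ℝ) ^ (j + 1))
        + 14 * d * (c₁ * (L : ℝ) ^ (j + 1)) ^ 2 * (cR * b₀)) ≤ 1 / 2) :
    ∃ (u : Site d → (Matrix n n ℂ)ˣ) (Z : Site d → Fin d → (Matrix n n ℂ)),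
      IsUnitarySite u ∧ IsPeriodicSite u ((N * L ^ (j + 1) : ℕ) : ℤ) ∧ IsSkewDir Z ∧ IsPeriodicDir Z ((N * L ^ (j + 1) : ℕ) : ℤ) ∧
      gaugeAct u U = vary W Z 1 ∧ IsLandauB8 (d := d) L N (j + 1) W Z ∧
      (∀ (y : Site d) (μ : Fin d), ‖(((W y μ)⁻¹ * gaugeAct u U y μ : (Matrix n n ℂ)ˣ) : (Matrix n n ℂ)) - 1‖ ≤ r₀ + 5 / 2 * (c₁ * (L : ℝ) ^ (j + 1) * (cR * b₀))) ∧
      (∀ (y : Site d) (μ : Fin d), ‖Z y μ‖ ≤ 2 * (r₀ + 5 / 2 * (c₁ * (L : ℝ) ^ (j + 1) * (cR * b₀)))) ∧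
      (∀ y : Site d, ‖((u y : (Matrix n n ℂ)ˣ) : (Matrix n n ℂ)) - 1‖ ≤ 4 * (c₀ * ((L : ℝ) ^ (j + 1)) ^ 2 * (cR * b₀))) ∧
      (∀ x : Site d, ‖covDiv W Z x‖ ≤ b₀ + 3 * (cR * b₀)) := by
  letI : NormedAlgebra ℚ (Matrix n n ℂ) := NormedAlgebra.restrictScalars ℚ ℝ (Matrix n n ℂ)
  letI : CStarAlgebra (Matrix n n ℂ) := {}
  have hP : 1 ≤ N * L ^ (j + 1) := Nat.mul_pos (by omega) (Nat.pow_pos (by omega))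
  obtain ⟨useq, hseq⟩ := exists_newton_sequence_W hd hL hN j hc₀ hc₁ hcR hWu hWP hx hs hWx hG hR hUu hUP hr₀ hb₀ hreg₁ hreg₂ hreg₃ hline
  set M : ℝ := (L : ℝ) ^ (j + 1) with hM
  set rbar : ℝ := r₀ + 5 / 2 * (c₁ * M * (cR * b₀)) with hrbar
  have hrbar4 : rbar ≤ 1 / 4 := hreg₃.trans (by norm_num)
  -- pointwise limits of the gauges
  have hcau : ∀ y : Site d, CauchySeq fun i => ((useq i y : (Matrix n n ℂ)ˣ) : (Matrix n n ℂ)) := fun y =>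
    cauchySeq_of_le_geometric (1 / 2) (2 * (c₀ * M ^ 2 * (cR * b₀))) (by norm_num) fun i => by
      rw [dist_eq_norm, norm_sub_rev]; exact (hseq i).2.2.2.2.1 y
  choose ulim hul using fun y => cauchySeq_tendsto_of_complete (hcau y)
  have hmem : ∀ y : Site d, ulim y ∈ unitary (Matrix n n ℂ) := fun y =>
    isClosed_unitary.mem_of_tendsto (hul y) (Eventually.of_forall fun i => mem_unitaryUnits.mp ((hseq i).1 y))
  let ulimU : Site d → (Matrix n n ℂ)ˣ := fun y => Unitary.toUnits ⟨ulim y, hmem y⟩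
  have hval : ∀ y : Site d, ((ulimU y : (Matrix n n ℂ)ˣ) : (Matrix n n ℂ)) = ulim y := fun y => rfl
  have huU : IsUnitarySite ulimU := fun y => mem_unitaryUnits.mpr (by rw [hval]; exact hmem y)
  have huP : IsPeriodicSite ulimU ((N * L ^ (j + 1) : ℕ) : ℤ) := by
    intro y i
    have hfun : (fun k => ((useq k (y + ((N * L ^ (j + 1) : ℕ) : ℤ) • e i) : (Matrix n n ℂ)ˣ) : (Matrix n n ℂ))) = fun k => ((useq k y : (Matrix n n ℂ)ˣ) : (Matrix n n ℂ)) := by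
      funext k; rw [(hseq k).2.1 y i]
    have h1 := hul (y + ((N * L ^ (j + 1) : ℕ) : ℤ) • e i)
    rw [hfun] at h1
    exact Units.ext (by rw [hval, hval]; exact tendsto_nhds_unique h1 (hul y))
  -- convergence of the relative bond variables and the radius in the limit
  have hV : ∀ (y : Site d) (μ : Fin d),
      Tendsto (fun i => (((W y μ)⁻¹ * gaugeAct (useq i) U y μ : (Matrix n n ℂ)ˣ) : (Matrix n n ℂ))) atTop
        (𝓝 (((W y μ)⁻¹ * gaugeAct ulimU U y μ : (Matrix n n ℂ)ˣ) : (Matrix n n ℂ))) := by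
    intro y μ
    have hform : ∀ (v : Site d → (Matrix n n ℂ)ˣ), IsUnitarySite v →
        (((W y μ)⁻¹ * gaugeAct v U y μ : (Matrix n n ℂ)ˣ) : (Matrix n n ℂ))
          = (((W y μ)⁻¹ : (Matrix n n ℂ)ˣ) : Matrix n n ℂ) * ((v y : (Matrix n n ℂ)) * (U y μ : (Matrix n n ℂ)) * star ((v (y + e μ) : (Matrix n n ℂ)ˣ) : (Matrix n n ℂ))) :=
      fun v hv => by
      simp only [gaugeAct, Units.val_mul, val_inv_eq_star (hv (y + e μ)), mul_assoc]
    rw [hform ulimU huU]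
    simp only [hform (useq _) ((hseq _).1), hval]
    exact (((hul y).mul tendsto_const_nhds).mul (hul (y + e μ)).star).const_mul _
  have hr : ∀ (y : Site d) (μ : Fin d), ‖(((W y μ)⁻¹ * gaugeAct ulimU U y μ : (Matrix n n ℂ)ˣ) : (Matrix n n ℂ)) - 1‖ ≤ rbar := fun y μ =>
    le_of_tendsto ((hV y μ).sub_const 1).norm (Eventually.of_forall fun i => (hseq i).2.2.1 y μ)
  -- the limiting relative potential
  set Z : Site d → Fin d → (Matrix n n ℂ) := fun y μ => mlog (((W y μ)⁻¹ * gaugeAct ulimU U y μ : (Matrix n n ℂ)ˣ) : (Matrix n n ℂ)) with hZ_def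
  have hVu : IsUnitaryCfg (gaugeAct ulimU U) := isUnitaryCfg_gaugeAct_W huU hUu
  have hZs : IsSkewDir Z := isSkewDir_mlog_rel hWu hVu fun y μ => (hr y μ).trans hrbar4
  have hZP : IsPeriodicDir Z ((N * L ^ (j + 1) : ℕ) : ℤ) := isPeriodicDir_mlog_rel hWP (NE3ResidualSliceRep.isPeriodicCfg_gaugeAct huP hUP)
  have hrep : gaugeAct ulimU U = vary W Z 1 := by
    funext y μ
    refine Units.ext ?_
    have h1 : ‖(((W y μ)⁻¹ * gaugeAct ulimU U y μ : (Matrix n n ℂ)ˣ) : (Matrix n n ℂ)) - 1‖ < 1 := (hr y μ).trans_lt (by linarith)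
    have h2 : exp (Z y μ) = (((W y μ)⁻¹ * gaugeAct ulimU U y μ : (Matrix n n ℂ)ˣ) : (Matrix n n ℂ)) := exp_mlog h1
    rw [show (vary W Z 1 y μ : (Matrix n n ℂ)ˣ) = W y μ * expUnit (((1 : ℝ) : ℂ) • Z y μ) from rfl, Units.val_mul, val_expUnit,
      Complex.ofReal_one, one_smul, h2, Units.val_mul, ← mul_assoc, Units.mul_inv, one_mul]
  have hZlim : ∀ (y : Site d) (μ : Fin d), Tendsto (fun i => mlog (((W y μ)⁻¹ * gaugeAct (useq i) U y μ : (Matrix n n ℂ)ˣ) : (Matrix n n ℂ))) atTop (𝓝 (Z y μ)) := by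
    intro y μ
    rw [tendsto_iff_norm_sub_tendsto_zero]
    have h0 : Tendsto (fun i => 4 / 3 * ‖(((W y μ)⁻¹ * gaugeAct (useq i) U y μ : (Matrix n n ℂ)ˣ) : (Matrix n n ℂ))
        - (((W y μ)⁻¹ * gaugeAct ulimU U y μ : (Matrix n n ℂ)ˣ) : (Matrix n n ℂ))‖) atTop (𝓝 0) := by
      have := (tendsto_iff_norm_sub_tendsto_zero.mp (hV y μ)).const_mul (4 / 3)
      simpa using this
    exact squeeze_zero (fun _ => norm_nonneg _)
      (fun i => norm_mlog_sub_mlog_le_four_thirds hrbar4 ((hseq i).2.2.1 y μ) (hr y μ)) h0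
  have hcd : ∀ x : Site d, ‖covDiv W Z x‖ ≤ b₀ + 3 * (cR * b₀) := by
    intro x
    have ht : Tendsto (fun i => covDiv W (fun y μ => mlog (((W y μ)⁻¹ * gaugeAct (useq i) U y μ : (Matrix n n ℂ)ˣ) : (Matrix n n ℂ))) x) atTop
        (𝓝 (covDiv W Z x)) := by
      simp only [covDiv, Ad]
      exact tendsto_finsetSum _ fun μ _ =>
        (((hZlim x μ).const_mul _).mul_const _).sub (hZlim (x - e μ) μ)
    exact le_of_tendsto ht.norm (Eventually.of_forall fun i => (hseq i).2.2.2.1 x)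
  -- (1.38) in the limit
  have hLan : IsLandauB8 (d := d) L N (j + 1) W Z := by
    intro nu hnu
    have hnuP : ∀ (y : Site d) (i : Fin d), nu (y + ((N * L ^ (j + 1) : ℕ) : ℤ) • e i) = nu y := hnu.2.1
    set g : Site d → Fin d → (Matrix n n ℂ) := gaugeDir W (covLapSite W nu) with hg
    -- the pairing of the iterates tends to the pairing of the limit
    have hpair : ∀ (x : Site d) (κ : Fin d),
        Tendsto (fun i => hsR (mlog (((W x κ)⁻¹ * gaugeAct (useq i) U x κ : (Matrix n n ℂ)ˣ) : (Matrix n n ℂ))) (g x κ)) atTop (𝓝 (hsR (Z x κ) (g x κ))) := by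
      intro x κ
      rw [tendsto_iff_norm_sub_tendsto_zero]
      have h0 : Tendsto (fun i => ‖mlog (((W x κ)⁻¹ * gaugeAct (useq i) U x κ : (Matrix n n ℂ)ˣ) : (Matrix n n ℂ)) - Z x κ‖ * ‖g x κ‖) atTop (𝓝 0) := by
        have := (tendsto_iff_norm_sub_tendsto_zero.mp (hZlim x κ)).mul_const ‖g x κ‖
        simpa using this
      refine squeeze_zero (fun _ => norm_nonneg _) (fun i => ?_) h0
      rw [Real.norm_eq_abs, ← hsR_sub_left]
      exact abs_hsR_le _ _
    have hlim : Tendsto (fun i => ∑ x ∈ periodBox (d := d) (N * L ^ (j + 1)), ∑ κ : Fin d,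
        hsR (mlog (((W x κ)⁻¹ * gaugeAct (useq i) U x κ : (Matrix n n ℂ)ˣ) : (Matrix n n ℂ))) (g x κ)) atTop
        (𝓝 (∑ x ∈ periodBox (d := d) (N * L ^ (j + 1)), ∑ κ : Fin d, hsR (Z x κ) (g x κ))) :=
      tendsto_finsetSum _ fun x _ => tendsto_finsetSum _ fun κ _ => hpair x κ
    -- the pairing of the iterates is `O(2^{−i})`
    set C : ℝ := ∑ x ∈ periodBox (d := d) (N * L ^ (j + 1)), ‖covLapSite W nu x‖ with hC
    have hsmall : ∀ i : ℕ, |∑ x ∈ periodBox (d := d) (N * L ^ (j + 1)), ∑ κ : Fin d,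
        hsR (mlog (((W x κ)⁻¹ * gaugeAct (useq i) U x κ : (Matrix n n ℂ)ˣ) : (Matrix n n ℂ))) (g x κ)| ≤ (cR * b₀) * (1 / 2) ^ i * C := by
      intro i
      obtain ⟨lam, hlam, hLan_i, hD_i⟩ := (hseq i).2.2.2.2.2.2
      have hlamP : ∀ (y : Site d) (k : Fin d), lam (y + ((N * L ^ (j + 1) : ℕ) : ℤ) • e k) = lam y := hlam.2.1
      have h0 := hLan_i nu hnu
      have hsplit : ∑ x ∈ periodBox (d := d) (N * L ^ (j + 1)), ∑ κ : Fin d, hsR (mlog (((W x κ)⁻¹ * gaugeAct (useq i) U x κ : (Matrix n n ℂ)ˣ) : (Matrix n n ℂ))) (g x κ)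
          = -∑ x ∈ periodBox (d := d) (N * L ^ (j + 1)),
              hsR (covLapSite W lam x) (covLapSite W nu x) := by
        rw [← sum_hsR_gaugeDir_gaugeDir_covLapSite hP hWu hWP hlamP hnuP]
        simp only [hsR_add_left, Finset.sum_add_distrib] at h0
        rw [hg]
        linarith
      rw [hsplit, abs_neg]
      calc |∑ x ∈ periodBox (d := d) (N * L ^ (j + 1)),
              hsR (covLapSite W lam x) (covLapSite W nu x)|
          ≤ ∑ x ∈ periodBox (d := d) (N * L ^ (j + 1)),
              |hsR (covLapSite W lam x) (covLapSite W nu x)| :=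
            Finset.abs_sum_le_sum_abs _ _
        _ ≤ ∑ x ∈ periodBox (d := d) (N * L ^ (j + 1)),
              (cR * b₀) * (1 / 2) ^ i * ‖covLapSite W nu x‖ :=
            Finset.sum_le_sum fun x _ => (abs_hsR_le _ _).trans (mul_le_mul_of_nonneg_right (hD_i x) (norm_nonneg _))
        _ = (cR * b₀) * (1 / 2) ^ i * C := by rw [hC, Finset.mul_sum]
    have hzero : Tendsto (fun i => ∑ x ∈ periodBox (d := d) (N * L ^ (j + 1)), ∑ κ : Fin d,
        hsR (mlog (((W x κ)⁻¹ * gaugeAct (useq i) U x κ : (Matrix n n ℂ)ˣ) : (Matrix n n ℂ))) (g x κ)) atTop (𝓝 0) := by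
      have hgeom : Tendsto (fun i : ℕ => (cR * b₀) * (1 / 2 : ℝ) ^ i * C) atTop (𝓝 0) := by
        have := ((tendsto_pow_atTop_nhds_zero_of_lt_one (by norm_num : (0 : ℝ) ≤ 1 / 2) (by norm_num)).const_mul (cR * b₀)).mul_const C
        simpa using this
      exact squeeze_zero_norm (fun i => by rw [Real.norm_eq_abs]; exact hsmall i) hgeom
    exact tendsto_nhds_unique hlim hzero
  refine ⟨ulimU, Z, huU, huP, hZs, hZP, hrep, hLan, hr, fun y μ => ?_, fun y => ?_, hcd⟩
  · exact (norm_mlog_le_two_mul ((hr y μ).trans (by linarith))).trans (by linarith [hr y μ])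
  · exact le_of_tendsto ((hul y).sub_const 1).norm (Eventually.of_forall fun i => (hseq i).2.2.2.2.2.1 y)


/-- **THE EXACT (1.38)-LANDAU REPRESENTATIVE RELATIVE TO A BACKGROUND OF THE CLASS** with the tree's LEVEL-FREE curved letters plugged:
(H0_W) `SupRegularityCurvedUniform.supRegularity_uniform` (`c₀ = 36d(frameC+d)²`, `c₁ = 36d(frameC+d)`, under `SmallField W x`, covariant plaquette
gradients `≤ x₁`, `23040d⁴F²M²x ≤ 1`, `11520d⁴F³M³x₁ ≤ 1`) and (HR_W) `LandauProjectionSupCurvedUniform.covLapSite_sup_le_curved_uniform`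
(`c_R = 1 + 2·card n·(64d²N)^d + 27(card n)³512^dN^d`, under `256d²M²x ≤ 1`, `16dM³x₁ ≤ 1`).  Every `d ≥ 1`, `L ≥ 2`, `N ≥ 1`, `j`; the four numeric lines are
those of `exists_landauRep_W_of_supFacts` with these constants. [folklore] -/
theorem exists_landauRep_W [Nonempty n] (hd : 1 ≤ d) {L N : ℕ} [NeZero N] (hL : 2 ≤ L) (j : ℕ)
    {W : Site d → Fin d → (Matrix n n ℂ)ˣ} {x x₁ : ℝ} (hWu : IsUnitaryCfg W) (hWP : IsPeriodicCfg W ((N * L ^ (j + 1) : ℕ) : ℤ))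
    (hx : 0 ≤ x) (hs : LevelSmall d L j x) (hWx : SmallField W x) (hx10 : 0 ≤ x₁)
    (hgrad : ∀ (p : Site d) (μ κ : Fin d), κ ≠ μ →
      ‖Ad (W p μ) ((hol W (p + e μ) (plaqWord κ μ) : (Matrix n n ℂ)ˣ) : Matrix n n ℂ) - ((hol W p (plaqWord κ μ) : (Matrix n n ℂ)ˣ) : Matrix n n ℂ)‖ ≤ x₁)
    (hbx : 23040 * (d : ℝ) ^ 4 * (frameC d L + d) ^ 2 * ((L : ℝ) ^ (j + 1)) ^ 2 * x ≤ 1)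
    (hcx : 11520 * (d : ℝ) ^ 4 * (frameC d L + d) ^ 3 * ((L : ℝ) ^ (j + 1)) ^ 3 * x₁ ≤ 1)
    (hbx' : 256 * (d : ℝ) ^ 2 * ((L : ℝ) ^ (j + 1)) ^ 2 * x ≤ 1) (hcx' : 16 * (d : ℝ) * ((L : ℝ) ^ (j + 1)) ^ 3 * x₁ ≤ 1)
    {U : Site d → Fin d → (Matrix n n ℂ)ˣ} (hUu : IsUnitaryCfg U) (hUP : IsPeriodicCfg U ((N * L ^ (j + 1) : ℕ) : ℤ))
    {r₀ b₀ : ℝ} (hr₀ : ∀ (y : Site d) (μ : Fin d), ‖(((W y μ)⁻¹ * U y μ : (Matrix n n ℂ)ˣ) : (Matrix n n ℂ)) - 1‖ ≤ r₀)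
    (hb₀ : ∀ x : Site d, ‖covDiv W (fun y μ => mlog (((W y μ)⁻¹ * U y μ : (Matrix n n ℂ)ˣ) : (Matrix n n ℂ))) x‖ ≤ b₀)
    (hreg₁ : (36 * (d : ℝ) * (frameC d L + d) ^ 2) * ((L : ℝ) ^ (j + 1)) ^ 2
      * ((1 + 2 * (Fintype.card n : ℝ) * (64 * (d : ℝ) ^ 2 * N) ^ d + 27 * (Fintype.card n : ℝ) ^ 3 * (512 : ℝ) ^ d * (N : ℝ) ^ d) * b₀) ≤ 1 / 10)
    (hreg₂ : (36 * (d : ℝ) * (frameC d L + d)) * (L : ℝ) ^ (j + 1)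
      * ((1 + 2 * (Fintype.card n : ℝ) * (64 * (d : ℝ) ^ 2 * N) ^ d + 27 * (Fintype.card n : ℝ) ^ 3 * (512 : ℝ) ^ d * (N : ℝ) ^ d) * b₀) ≤ 1 / 25)
    (hreg₃ : r₀ + 5 / 2 * ((36 * (d : ℝ) * (frameC d L + d)) * (L : ℝ) ^ (j + 1)
      * ((1 + 2 * (Fintype.card n : ℝ) * (64 * (d : ℝ) ^ 2 * N) ^ d + 27 * (Fintype.card n : ℝ) ^ 3 * (512 : ℝ) ^ d * (N : ℝ) ^ d) * b₀)) ≤ 1 / 20)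
    (hline : (1 + 2 * (Fintype.card n : ℝ) * (64 * (d : ℝ) ^ 2 * N) ^ d + 27 * (Fintype.card n : ℝ) ^ 3 * (512 : ℝ) ^ d * (N : ℝ) ^ d)
      * (4 * ((36 * (d : ℝ) * (frameC d L + d) ^ 2) * ((L : ℝ) ^ (j + 1)) ^ 2)
          * (b₀ + 4 * ((1 + 2 * (Fintype.card n : ℝ) * (64 * (d : ℝ) ^ 2 * N) ^ d + 27 * (Fintype.card n : ℝ) ^ 3 * (512 : ℝ) ^ d * (N : ℝ) ^ d) * b₀))
        + 25 * d * (r₀ + 5 / 2 * ((36 * (d : ℝ) * (frameC d L + d)) * (L : ℝ) ^ (j + 1)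
            * ((1 + 2 * (Fintype.card n : ℝ) * (64 * (d : ℝ) ^ 2 * N) ^ d + 27 * (Fintype.card n : ℝ) ^ 3 * (512 : ℝ) ^ d * (N : ℝ) ^ d) * b₀)))
            * ((36 * (d : ℝ) * (frameC d L + d)) * (L : ℝ) ^ (j + 1))
        + 14 * d * ((36 * (d : ℝ) * (frameC d L + d)) * (L : ℝ) ^ (j + 1)) ^ 2
            * ((1 + 2 * (Fintype.card n : ℝ) * (64 * (d : ℝ) ^ 2 * N) ^ d + 27 * (Fintype.card n : ℝ) ^ 3 * (512 : ℝ) ^ d * (N : ℝ) ^ d) * b₀)) ≤ 1 / 2) :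
    ∃ (u : Site d → (Matrix n n ℂ)ˣ) (Z : Site d → Fin d → (Matrix n n ℂ)),
      IsUnitarySite u ∧ IsPeriodicSite u ((N * L ^ (j + 1) : ℕ) : ℤ) ∧ IsSkewDir Z ∧ IsPeriodicDir Z ((N * L ^ (j + 1) : ℕ) : ℤ) ∧
      gaugeAct u U = vary W Z 1 ∧ IsLandauB8 (d := d) L N (j + 1) W Z ∧
      (∀ (y : Site d) (μ : Fin d), ‖(((W y μ)⁻¹ * gaugeAct u U y μ : (Matrix n n ℂ)ˣ) : (Matrix n n ℂ)) - 1‖ ≤ r₀ + 5 / 2 * ((36 * (d : ℝ) * (frameC d L + d)) * (L : ℝ) ^ (j + 1)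
        * ((1 + 2 * (Fintype.card n : ℝ) * (64 * (d : ℝ) ^ 2 * N) ^ d + 27 * (Fintype.card n : ℝ) ^ 3 * (512 : ℝ) ^ d * (N : ℝ) ^ d) * b₀))) ∧
      (∀ (y : Site d) (μ : Fin d), ‖Z y μ‖ ≤ 2 * (r₀ + 5 / 2 * ((36 * (d : ℝ) * (frameC d L + d)) * (L : ℝ) ^ (j + 1)
        * ((1 + 2 * (Fintype.card n : ℝ) * (64 * (d : ℝ) ^ 2 * N) ^ d + 27 * (Fintype.card n : ℝ) ^ 3 * (512 : ℝ) ^ d * (N : ℝ) ^ d) * b₀)))) ∧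
      (∀ y : Site d, ‖((u y : (Matrix n n ℂ)ˣ) : (Matrix n n ℂ)) - 1‖ ≤ 4 * ((36 * (d : ℝ) * (frameC d L + d) ^ 2) * ((L : ℝ) ^ (j + 1)) ^ 2
        * ((1 + 2 * (Fintype.card n : ℝ) * (64 * (d : ℝ) ^ 2 * N) ^ d + 27 * (Fintype.card n : ℝ) ^ 3 * (512 : ℝ) ^ d * (N : ℝ) ^ d) * b₀))) ∧
      (∀ x : Site d, ‖covDiv W Z x‖
        ≤ b₀ + 3 * ((1 + 2 * (Fintype.card n : ℝ) * (64 * (d : ℝ) ^ 2 * N) ^ d + 27 * (Fintype.card n : ℝ) ^ 3 * (512 : ℝ) ^ d * (N : ℝ) ^ d) * b₀)) := by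
  have hN : 1 ≤ N := Nat.one_le_iff_ne_zero.mpr (NeZero.ne N)
  have hF0 : 0 ≤ frameC d L + d := zero_le_one.trans (one_le_frameC_add hd L)
  refine exists_landauRep_W_of_supFacts hd hL hN j (c₀ := 36 * (d : ℝ) * (frameC d L + d) ^ 2) (c₁ := 36 * (d : ℝ) * (frameC d L + d))
    (cR := 1 + 2 * (Fintype.card n : ℝ) * (64 * (d : ℝ) ^ 2 * N) ^ d + 27 * (Fintype.card n : ℝ) ^ 3 * (512 : ℝ) ^ d * (N : ℝ) ^ d)
    (by positivity) (by positivity) ?_ hWu hWP hx hs hWx ?_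
    (fun F hFs hFP mu hmu horth B hFB y => covLapSite_sup_le_curved_uniform hd hL hN j hWu hWP hx hs hWx hx10 hgrad hbx' hcx' F hFs hFP hmu horth hFB y)
    hUu hUP hr₀ hb₀ hreg₁ hreg₂ hreg₃ hline
  · have : (0 : ℝ) ≤ 2 * (Fintype.card n : ℝ) * (64 * (d : ℝ) ^ 2 * N) ^ d + 27 * (Fintype.card n : ℝ) ^ 3 * (512 : ℝ) ^ d * (N : ℝ) ^ d := by
      positivity
    linarith
  · intro mu hmu B hB
    obtain ⟨hD, hU⟩ := supRegularity_uniform hd hL j hWu hWP hx hs hWx hx10 hgrad hbx hcx hmu hB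
    exact ⟨fun y => (hU y).trans (le_of_eq (by ring)), fun y μ => (hD y μ).trans (le_of_eq (by ring))⟩

end

end Summit.QuantumFields.BalabanUV.T4Continuum.NE3.CurvedLandauRep
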